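import Summits.MatrixMultiplication.MatrixMultiplication.Theses.CondensationDistance

/-!
# Sketch (strategist r1, stmt-MatrixMultiplication-15936): the TOP-t invariant, typed

Typed statements quoted in STRATEGY-CENSUS v5 §0c / N7 and in the crux idea `top-rigidity-ladder`
(lens: negation). Nothing here is an item; `stub_*` are the idea's first lemmas (sorried on purpose).
-/

set_option linter.dupNamespace false
set_option linter.unusedVariables false

namespace Summit.MatrixMultiplication.MatrixMultiplication.Cruxes.ShortCondensation.TopRigidity

open Summit.MatrixMultiplication.MatrixMultiplication.Theses.CondensationDistance

/-- height of an `n`-set of `Fin (n+m')` = number of non-identity columns = size of the minor `P_J`. -/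
def height (n m' : ℕ) (J : Finset (Fin (n + m'))) : ℕ := (J.filter fun x : Fin (n + m') => n ≤ x.val).card

/-- the route's step rule, verbatim (every listed set has an octahedron whose five mates are in the
radius-1 ball or listed earlier). -/
def Valid (n m' l : ℕ) (f : Fin l → Finset (Fin (n + m'))) : Prop :=
  ∀ i : Fin l, ∃ p ∈ f i, ∃ q ∈ f i, p ≠ q ∧ ∃ u ∉ f i, ∃ v ∉ f i, u ≠ v ∧
    ∀ J ∈ [insert u ((f i).erase p), insert v ((f i).erase p), insert u ((f i).erase q), insert v ((f i).erase q),
      insert u (insert v (((f i).erase p).erase q))],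
      (J.card = n ∧ (J.filter fun x : Fin (n + m') => n ≤ x.val).card ≤ 1) ∨ ∃ j : Fin l, j < i ∧ f j = J

/-- the target `{n ≤ x < 2n}` = the columns of `X`. -/
def target (n m' : ℕ) : Finset (Fin (n + m')) := Finset.univ.filter fun x : Fin (n + m') => n ≤ x.val ∧ x.val < 2 * n

/-- `topCount f t` = number of DISTINCT listed sets of height `≥ n - t` (the top `t+1` levels, `T` included). -/
def topCount (n m' l : ℕ) (f : Fin l → Finset (Fin (n + m'))) (t : ℕ) : ℕ :=
  ((Finset.univ.image f).filter fun J => n - t ≤ height n m' J).card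

/-- **TR(t) ≥ N** ("top-heavy"): every valid derivation of `det X_n` inside ANY `J(n+m', n)` (any number of
auxiliary columns, any ambient size `n ≥ t+2`) lists at least `N` distinct sets in its top `t+1` levels.
By restriction (census §0c, F1) this is `c_t(n, m'-n) ≥ N` for all `n, m'`, i.e. `c_t(∞,∞) ≥ N`. -/
def TopHeavy (t N : ℕ) : Prop :=
  ∀ n m' : ℕ, t + 2 ≤ n → n ≤ m' → ∀ (l : ℕ) (f : Fin l → Finset (Fin (n + m'))),
    Valid n m' l f → (∃ i : Fin l, f i = target n m') → N ≤ topCount n m' l f t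

/-- First lemma of the negation line (machine-closed for `n ≤ 10`, `≤ 6` auxiliary columns touched at the
top, census §0c): **the last three levels of every derivation hold ≥ 14 = 1 + 4 + 9 sets** (Dodgson-tight).
Hand proof expected: ordered charging (first-listed cofactor needs a 2×2 grid of bought second cofactors,
each further cofactor ≥ 2 fresh ones unless exchange-adjacent to two earlier ones) + the aux-column count
of AuxColumnsN4 Lemma 2. Size M. -/
theorem stub_topHeavy_two : TopHeavy 2 14 := by
  sorry

/-- Second lemma (the live finite question, kit j027382): TR(3), i.e. `D(5) = 30` and no ambient /
auxiliary gain at depth ≤ 3. Size L (D(5) ∈ {29, 30} is a standing SAT gap). -/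
theorem stub_topHeavy_three : TopHeavy 3 30 := by
  sorry

/-- **Kill form** (census §0c, F3, contrapositive): a super-quadratic top, infinitely often, refutes the crux.
Pure ε-bookkeeping over `ShortCondensation` (l ≥ #distinct listed ≥ topCount ≥ N > n^(2+ε) at n = t+2 for a
suitable ε < δ); size S/M. -/
theorem stub_topKill :
    (∃ δ : ℝ, 0 < δ ∧ ∀ t₀ : ℕ, ∃ t ≥ t₀, ∃ N : ℕ, TopHeavy t N ∧ ((t : ℝ) + 2) ^ (2 + δ) < N) →
      ¬ ShortCondensation := by
  sorry

/-- Sanity (the definitions compute): the top count of the empty derivation is `0`. -/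
example : topCount 2 2 0 (fun i => Fin.elim0 i) 0 = 0 := by decide

end Summit.MatrixMultiplication.MatrixMultiplication.Cruxes.ShortCondensation.TopRigidity
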